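import Summits.Ventures.PercRepro.ProfileGapMonoTop
import Summits.Ventures.PercRepro.ProfileThreeMinors

/-!
# PercRepro — THE GENERIC TEMPLATE, PART A: genericity, the demand side and the binomial step (p5, gen 21;
`proofs/P5-GM1.md` §10; announced INBOX 9980; PART A OF THE SPLIT of ProfileGapMonoGeneric.lean (428 l., sha256
a8fb8240b5700d498dfc84e3038db2d29b966f9c5cf4b665be501a217f0f6dff), lines 1–224, bodies byte-identical; RULING (um)(64) / lint.size)

`GenericAt M z q` says: no set `X ⊆ E ∖ z` of rank `≤ q` has `z` outside the closure of its complement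
(`z` lies in no cocircuit `D` with `ρ(D ∖ z) ≤ q`; in particular `z` is not a coloop).  At such a point, with
`N := M ／ z`: every rank-`q` set avoiding `z` keeps its demand under the deletion of `z`; every rank-`q` set
through `z` is `insert z B'` for a rank-`(q−1)` set `B'` of `N` and demands `[m+1 ≥ u]·C(m+1, u−q)` where
`m := ρ_N(E' ∖ B')` — at most `(u/q)` times the `(q−1, u−1)`-demand of `B'` in `N`; and the co-rank-`(q−1)`
rank-`(u−1)` sets of `N` inject into the new co-rank-`q` rank-`u` sets of `M` (through `z`, or LOST — the
complement loses the coloop `z`), provided `u + q ≤ ρ(E) + 1`.  Hence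
`gap_q(M;u) − gap_q(M∖z;u) ≥ (u/q)·gap_{q−1}(N;u−1)`, and `(GM)_q` at `z` follows from
`ProfileIneqMinusQ (M ／ z) (q−1) (u−1)`.  With the co-rank-`1` row (`profileIneqMinusQ_one_all`) this gives
`(GM)_2` at every `2`-generic point below the top level.

* `GenericAt`, `genericAt_notColoop`;
* `demand_delete_of_genericAt`, `demand_insert_of_genericAt`, `sum_demand_genericAt` — the demand side;
* `choose_succ_mul_le_gen` — `q·C(m+1, u−q) ≤ u·C(m, u−q)` for `m ≥ u − 1`;
(the supply side and the template are in ProfileGapMonoGenericB.)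
-/

open scoped Matroid

namespace PercRepro.Cogirth

open Finset ThmH Skew Shadow Profile

variable {α : Type} [DecidableEq α] {M : Matroid α} [M.Finite]

/-! ### Rank facts -/

/-- `ρ(X ∪ e) = ρ(X)` when `e ∈ cl X`. -/
theorem rk_insert_eq_of_mem_closure_gen {e : α} {X : Finset α} (h : e ∈ M.closure (X : Set α)) :
    rk M (insert e X) = rk M X := by
  unfold rk
  rw [Finset.coe_insert, ← M.eRk_closure_eq (insert e (X : Set α)),
    Matroid.closure_insert_eq_of_mem_closure h, M.eRk_closure_eq]

/-- `ρ(X ∪ e) = ρ(X) + 1` when `e ∈ E ∖ cl X`. -/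
theorem rk_insert_eq_succ_of_notMem_closure_gen {e : α} (he : e ∈ gr M) {X : Finset α}
    (h : e ∉ M.closure (X : Set α)) : rk M (insert e X) = rk M X + 1 := by
  have heE : e ∈ M.E := by rw [← coe_gr]; exact_mod_cast he
  have h1 := M.eRk_insert_eq_add_one (X := (X : Set α)) ⟨heE, h⟩
  rw [← Finset.coe_insert, ← coe_rk, ← coe_rk] at h1
  exact_mod_cast h1

omit [DecidableEq α] in
/-- A finset is independent iff its rank is its cardinality. -/
theorem indep_iff_rk_eq_card_gen (X : Finset α) : M.Indep (X : Set α) ↔ rk M X = X.card := by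
  rw [Matroid.indep_iff_eRk_eq_encard_of_finite (finite_toSet X), Set.encard_coe_eq_coe_finsetCard, ← coe_rk]
  exact ⟨fun h => by exact_mod_cast h, fun h => by exact_mod_cast h⟩

omit [DecidableEq α] in
/-- A point of rank `1` is independent. -/
theorem indep_singleton_of_rk_one {z : α} (hz1 : rk M {z} = 1) : M.Indep ({z} : Set α) := by
  have := (indep_iff_rk_eq_card_gen (M := M) {z}).2 (by rw [hz1, card_singleton])
  simpa using this

/-- Submodularity on a finset and its complement in a finset: `ρ(Y) ≤ ρ(X) + ρ(Y ∖ X)`. -/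
theorem rk_le_rk_add_rk_sdiff (X Y : Finset α) : rk M Y ≤ rk M X + rk M (Y \ X) := by
  have h := M.eRk_union_le_eRk_add_eRk (X : Set α) ((Y \ X : Finset α) : Set α)
  rw [← Finset.coe_union, ← coe_rk, ← coe_rk, ← coe_rk] at h
  have h2 : rk M Y ≤ rk M (X ∪ (Y \ X)) := rk_mono_sub (by
    intro x hx; rw [mem_union, mem_sdiff]; by_cases hxX : x ∈ X
    · exact Or.inl hxX
    · exact Or.inr ⟨hx, hxX⟩)
  have h3 : rk M (X ∪ (Y \ X)) ≤ rk M X + rk M (Y \ X) := by exact_mod_cast h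
  omega

/-! ### Genericity -/

/-- **`z` is `q`-generic**: no set `X ⊆ E ∖ z` of rank `≤ q` has `z` outside the closure of `E ∖ z ∖ X`
(the rank form of «`z` lies in no cocircuit `D` with `ρ(D ∖ z) ≤ q`»). -/
def GenericAt (M : Matroid α) [M.Finite] (z : α) (q : ℕ) : Prop :=
  ∀ X ⊆ (gr M).erase z, rk M X ≤ q → z ∈ M.closure (((gr M).erase z \ X : Finset α) : Set α)

section Generic

variable {z : α} {q u : ℕ} (hz : z ∈ gr M) (hz1 : rk M {z} = 1) (hgen : GenericAt M z q)

include hgen in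
/-- A generic point is not a coloop: `ρ(E ∖ z) = ρ(E)`. -/
theorem rk_erase_of_genericAt : rk M ((gr M).erase z) = rk M (gr M) := by
  have h := hgen ∅ (empty_subset _) (by
    have : rk M (∅ : Finset α) ≤ (∅ : Finset α).card := rk_le_card' _
    rw [card_empty] at this; omega)
  rw [sdiff_empty] at h
  have h2 := rk_insert_eq_of_mem_closure_gen h
  by_cases hzE : z ∈ gr M
  · rw [insert_erase hzE] at h2; exact h2.symm
  · rw [erase_eq_of_notMem hzE]

include hz hgen in
/-- For `X ⊆ E ∖ z` of rank `≤ q`: the complement rank does not change when `z` is erased. -/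
theorem rk_sdiff_erase_of_genericAt {X : Finset α} (hX : X ⊆ (gr M).erase z) (hr : rk M X ≤ q) :
    rk M ((gr M \ X).erase z) = rk M (gr M \ X) := by
  have h := hgen X hX hr
  rw [erase_sdiff] at h
  have h2 := rk_insert_eq_of_mem_closure_gen h
  have hzX : z ∉ X := fun hzX => (mem_erase.1 (hX hzX)).1 rfl
  rw [insert_erase (mem_sdiff.2 ⟨hz, hzX⟩)] at h2
  exact h2.symm

include hz hgen in
/-- The demand of a rank-`q` set avoiding `z` is the same in `M` and in `M ∖ z`. -/
theorem demand_delete_of_genericAt {B : Finset α} (hB : B ∈ Rq M q) (hzB : z ∉ B) :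
    demand (M ＼ ({z} : Set α)) q u B = demand M q u B := by
  rw [demand_delete_eq_ite']
  unfold demand
  rw [mem_Rq] at hB
  have hBq : rk M B = q := by unfold rk; rw [hB.2]; exact ENat.toNat_coe q
  rw [rk_sdiff_erase_of_genericAt hz hgen (subset_erase.2 ⟨hB.1, hzB⟩) hBq.le]

include hz in
/-- The rank-`q` sets through `z` are `insert z` of the rank-`(q−1)` sets of `M ／ z` (`1 ≤ q`). -/
theorem Rq_filter_mem_eq_image_contract (hz1 : rk M {z} = 1) (hq : 1 ≤ q) :
    (Rq M q).filter (fun B => z ∈ B) = (Rq (M ／ ({z} : Set α)) (q - 1)).image (insert z) := by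
  have hind := indep_singleton_of_rk_one hz1
  ext B
  rw [mem_filter, mem_image]
  constructor
  · rintro ⟨hB, hzB⟩
    refine ⟨B.erase z, ?_, insert_erase hzB⟩
    rw [mem_Rq] at hB ⊢
    obtain ⟨hBg, hBr⟩ := hB
    have hsub : B.erase z ⊆ (gr M).erase z := erase_subset_erase z hBg
    have h := rk_contract_add_one hind hsub
    rw [insert_erase hzB] at h
    have hBq : rk M B = q := by unfold rk; rw [hBr]; exact ENat.toNat_coe q
    refine ⟨by rw [gr_contract']; exact hsub, ?_⟩
    rw [← coe_rk]
    have : rk (M ／ ({z} : Set α)) (B.erase z) = q - 1 := by omega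
    rw [this]
  · rintro ⟨B', hB', rfl⟩
    rw [mem_Rq] at hB'
    obtain ⟨hBg, hBr⟩ := hB'
    rw [gr_contract'] at hBg
    have h := rk_contract_add_one hind hBg
    have hBq : rk (M ／ ({z} : Set α)) B' = q - 1 := by unfold rk; rw [hBr]; exact ENat.toNat_coe _
    refine ⟨?_, mem_insert_self z B'⟩
    rw [mem_Rq]
    refine ⟨insert_subset hz ((subset_erase.1 hBg).1), ?_⟩
    rw [← coe_rk]
    have : rk M (insert z B') = q := by omega
    rw [this]

include hz hgen in
/-- The demand of `insert z B'` for a rank-`(q−1)` set `B'` of `M ／ z`, read in `M ／ z`: with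
`m := ρ_{M／z}(E' ∖ B')`, it is `[u ≤ m + 1]·C(m + 1, u − q)`. -/
theorem demand_insert_of_genericAt (hz1 : rk M {z} = 1) (hq : 1 ≤ q) {B' : Finset α}
    (hB' : B' ∈ Rq (M ／ ({z} : Set α)) (q - 1)) :
    demand M q u (insert z B') =
      if u ≤ rk (M ／ ({z} : Set α)) (gr (M ／ ({z} : Set α)) \ B') + 1 then
        (rk (M ／ ({z} : Set α)) (gr (M ／ ({z} : Set α)) \ B') + 1).choose (u - q) else 0 := by
  have hind := indep_singleton_of_rk_one hz1
  rw [mem_Rq] at hB'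
  obtain ⟨hBg, hBr⟩ := hB'
  rw [gr_contract'] at hBg ⊢
  have hzB : z ∉ B' := fun h => (mem_erase.1 (hBg h)).1 rfl
  -- `ρ_M B' ≤ q`
  have hBq' : rk (M ／ ({z} : Set α)) B' = q - 1 := by unfold rk; rw [hBr]; exact ENat.toNat_coe _
  have hcon := rk_contract_add_one hind hBg
  have hBle : rk M B' ≤ q := by
    have : rk M B' ≤ rk M (insert z B') := rk_mono_sub (subset_insert z B')
    omega
  -- the complement of `insert z B'` in `M` is `(E ∖ z) ∖ B'`, of `M`-rank `m + 1`
  have hcomp : gr M \ insert z B' = (gr M).erase z \ B' := by rw [sdiff_insert, erase_sdiff]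
  have hsub : (gr M).erase z \ B' ⊆ (gr M).erase z := sdiff_subset
  have hcon2 := rk_contract_add_one hind hsub
  have hins : insert z ((gr M).erase z \ B') = gr M \ B' := by
    rw [erase_sdiff, insert_erase (mem_sdiff.2 ⟨hz, hzB⟩)]
  rw [hins] at hcon2
  have hgen' := rk_sdiff_erase_of_genericAt hz hgen (subset_erase.2 ⟨(subset_erase.1 hBg).1, hzB⟩) hBle
  unfold demand
  rw [hcomp, erase_sdiff, hgen', ← hcon2, erase_sdiff]

include hz hgen in
/-- **The demand side**: `D_q(M) = D_q(M ∖ z) + Σ_{B' ∈ R_{q−1}(M／z)} [u ≤ m+1]·C(m+1, u−q)`. -/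
theorem sum_demand_genericAt (hz1 : rk M {z} = 1) (hq : 1 ≤ q) :
    ∑ B ∈ Rq M q, demand M q u B =
      ∑ B ∈ Rq (M ＼ ({z} : Set α)) q, demand (M ＼ ({z} : Set α)) q u B +
        ∑ B' ∈ Rq (M ／ ({z} : Set α)) (q - 1),
          (if u ≤ rk (M ／ ({z} : Set α)) (gr (M ／ ({z} : Set α)) \ B') + 1 then
            (rk (M ／ ({z} : Set α)) (gr (M ／ ({z} : Set α)) \ B') + 1).choose (u - q) else 0) := by
  rw [← sum_filter_add_sum_filter_not (Rq M q) (fun B => z ∈ B) (demand M q u), add_comm,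
    Rq_delete_eq_filter, Rq_filter_mem_eq_image_contract hz hz1 hq]
  have hinj : Set.InjOn (insert z) ((Rq (M ／ ({z} : Set α)) (q - 1) : Finset (Finset α)) : Set (Finset α)) := by
    intro B hB B' hB' h
    rw [mem_coe, mem_Rq, gr_contract'] at hB hB'
    have h1 : z ∉ B := fun hzB => (mem_erase.1 (hB.1 hzB)).1 rfl
    have h2 : z ∉ B' := fun hzB => (mem_erase.1 (hB'.1 hzB)).1 rfl
    rw [← erase_insert h1, ← erase_insert h2, h]
  rw [sum_image hinj]
  congr 1
  · exact sum_congr rfl (fun B hB => by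
      rw [mem_filter] at hB
      exact (demand_delete_of_genericAt hz hgen hB.1 hB.2).symm)
  · exact sum_congr rfl (fun B' hB' => demand_insert_of_genericAt hz hgen hz1 hq hB')

end Generic

/-! ### The binomial step -/

/-- `q · C(m+1, u−q) ≤ u · C(m, u−q)` for `1 ≤ q < u` and `u − 1 ≤ m`. -/
theorem choose_succ_mul_le_gen {q u m : ℕ} (hq : 1 ≤ q) (hqu : q < u) (hm : u - 1 ≤ m) :
    q * (m + 1).choose (u - q) ≤ u * m.choose (u - q) := by
  obtain ⟨k, hk⟩ : ∃ k, u - q = k + 1 := ⟨u - q - 1, by omega⟩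
  rw [hk, Nat.choose_succ_succ]
  have h := Nat.choose_succ_right_eq m k
  have hmq : q ≤ m - k := by omega
  have h1 : q * m.choose k ≤ (k + 1) * m.choose (k + 1) := by
    calc q * m.choose k ≤ (m - k) * m.choose k := Nat.mul_le_mul_right _ hmq
      _ = m.choose (k + 1) * (k + 1) := by rw [Nat.mul_comm, ← h]
      _ = (k + 1) * m.choose (k + 1) := Nat.mul_comm _ _
  have hu : u = q + (k + 1) := by omega
  calc q * (m.choose k + m.choose (k + 1)) = q * m.choose k + q * m.choose (k + 1) := Nat.mul_add _ _ _
    _ ≤ (k + 1) * m.choose (k + 1) + q * m.choose (k + 1) := Nat.add_le_add_right h1 _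
    _ = (q + (k + 1)) * m.choose (k + 1) := by ring
    _ = u * m.choose (k + 1) := by rw [hu]

end PercRepro.Cogirth
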